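import Literature.AlgebraicTopology.SingularHomology.SphereHomology
import Mathlib.RepresentationTheory.Rep.Iso
import Mathlib.CategoryTheory.Preadditive.Projective.Resolution
import Mathlib.Algebra.Homology.SingleHomology
import Mathlib.Topology.Algebra.ConstMulAction
import HarnessLib

/-!
# Singular chains of a `G`-space as a complex of representations; free actions give free chains

Topic `Literature/AlgebraicTopology/SingularHomology`.  K. S. Brown, *Cohomology of Groups* (GTM 87,
1982), Ch. I §4 ("if `X` is a free `G`-complex then `C_*(X)` is a complex of free `ℤG`-modules …
if moreover `X` is contractible, `C_*(X) → ℤ` is a free resolution", Prop. I.4.1 ff.; for singular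
chains Ch. I Ex. 4 / §I.6); A. Hatcher, *Algebraic Topology* (2002), §1.B p. 90 and §3.H
("`Cₙ(X̃)` is a free `ℤ[G]`-module with basis the lifts of the singular simplices of `X`").

For a group `G` acting on a space `E` by homeomorphisms (`MulAction G E`,
`ContinuousConstSMul G E`) and a commutative ring `k`, everything PROVED:

* `SingularSimplex.instMulAction` — `G` acts on singular simplices by `g • σ = (g • ·) ∘ σ`;
  `face_smul`, `toContinuousMap_smul`; for a FREE action (`IsCancelSMul G E`) the action on
  simplices is free (`SingularSimplex.smul_eq_smul_iff`).
* `Equivariant.chainRep n` — the permutation representation of `G` on the concrete `n`-chains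
  `Cₙ(E; k) = (SingularSimplex E n →₀ k)` (`csingularChainComplex`, `SingularChainsConcrete.lean`);
  `Equivariant.smod k G E : SimplicialObject (Rep k G)` and
  **`Equivariant.chains k G E : ChainComplex (Rep k G) ℕ`**, the singular chain complex as a
  complex of `k`-linear `G`-representations; forgetting the action gives back the concrete
  singular chain complex ON THE NOSE (`smod_comp_forget₂`, `forget₂_chains`), `d_hom_apply`.
* **Freeness** (Brown I.4 / Hatcher §1.B): for a free action each `Cₙ(E; k)` is isomorphic, as a
  representation, to the free representation `Rep.free k G (orbits of n-simplices)`
  (`Equivariant.chainsXIsoFree`), hence is projective in `Rep k G` (`Equivariant.projective_X`).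
* **The augmentation** `Equivariant.ε : chains k G E ⟶ (single₀).obj (Rep.trivial k G k)` (sum of
  coefficients) and **`Equivariant.resolution`**: if `E` is path connected and its singular
  homology vanishes in positive degrees (e.g. `E` contractible), `C_*(E; k) → k` is a PROJECTIVE
  RESOLUTION of the trivial representation `k` (Brown, Prop. I.4.1/I.4.2; Mathlib's
  `ProjectiveResolution`), so that `Extⁿ_{Rep k G}(k, A)` — Mathlib's group cohomology,
  `groupCohomologyIsoExt` — is computed by `Hom_G(C_*(E; k), A)` (`ProjectiveResolution.isoExt`).

The identification of `Hom_G(C_*(E; k), M)` with the singular cochains of the quotient `E/G` for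
a covering action is in `EquivariantSingularCochains.lean`.

## References

* K. S. Brown, *Cohomology of Groups*, GTM 87, Springer 1982, Ch. I §4 (Prop. 4.1, 4.2), §6.
  [Brown1982CohomologyGroups]
* A. Hatcher, *Algebraic Topology*, CUP 2002, §1.B p. 90, §3.H. [HatcherAT2002]
-/

noncomputable section

-- as in `SingularChainsConcrete`: the chain modules are `Finsupp`s up to unfolding of
-- semireducible definitions (`ChainComplex.of`, `AlternatingFaceMapComplex`)
set_option backward.isDefEq.respectTransparency false

open CategoryTheory CategoryTheory.Limits Opposite Simplicial AlgebraicTopology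

universe u

namespace Literature.AlgebraicTopology.SingularHomology

variable (k : Type u) [CommRing k] (G : Type u) [Group G] (E : Type u) [TopologicalSpace E]
  [MulAction G E] [ContinuousConstSMul G E]

/-! ### The action on singular simplices -/

/-- Translation by `g` as a continuous self-map of `E`. [folklore] -/
def smulMap (g : G) : C(E, E) := ⟨fun e => g • e, continuous_const_smul g⟩

/-- `smulMap g e = g • e`. [folklore] -/
@[simp] theorem smulMap_apply (g : G) (e : E) : smulMap G E g e = g • e := rfl

/-- `smulMap 1 = id`. [folklore] -/
theorem smulMap_one : smulMap G E 1 = ContinuousMap.id E := by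
  ext e
  simp

/-- `smulMap (g * h) = smulMap g ∘ smulMap h`. [folklore] -/
theorem smulMap_mul (g h : G) : smulMap G E (g * h) = (smulMap G E g).comp (smulMap G E h) := by
  ext e
  simp [mul_smul]

variable {G E}

/-- **`G` acts on the singular simplices of a `G`-space** by post-composition,
`g • σ = (g • ·) ∘ σ` (Brown 1982, I §4; Hatcher 2002, §1.B p. 90). [cite: Brown1982CohomologyGroups, Ch. I §4] -/
instance SingularSimplex.instMulAction (n : ℕ) : MulAction G (SingularSimplex E n) where
  smul g σ := σ.map (smulMap G E g)
  one_smul σ := by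
    change σ.map (smulMap G E 1) = σ
    rw [smulMap_one, SingularSimplex.map_id]
  mul_smul g h σ := by
    change σ.map (smulMap G E (g * h)) = (σ.map (smulMap G E h)).map (smulMap G E g)
    rw [smulMap_mul, SingularSimplex.map_comp]

namespace SingularSimplex

variable {n : ℕ}

/-- Unfolding of the action on simplices. [folklore] -/
theorem smul_def (g : G) (σ : SingularSimplex E n) : g • σ = σ.map (smulMap G E g) := rfl

/-- The action on simplices as continuous maps: `g • σ = (g • ·) ∘ σ`. [folklore] -/
theorem toContinuousMap_smul (g : G) (σ : SingularSimplex E n) :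
    toContinuousMap (g • σ) = (smulMap G E g).comp (toContinuousMap σ) :=
  toContinuousMap_map _ _

/-- Faces are equivariant: `(g • σ) ∘ δᵢ = g • (σ ∘ δᵢ)`. [folklore] -/
@[simp] theorem face_smul (g : G) (σ : SingularSimplex E (n + 1)) (i : Fin (n + 2)) :
    (g • σ).face i = g • σ.face i :=
  face_map _ _ _

/-- A map constant on orbits sends `g • σ` and `σ` to the same simplex:
`p ∘ (g • σ) = p ∘ σ` when `p (g • e) = p e`. [folklore] -/
theorem map_smul_of_forall_apply_smul {B : Type u} [TopologicalSpace B] (p : C(E, B))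
    (hp : ∀ (g : G) (e : E), p (g • e) = p e) (g : G) (σ : SingularSimplex E n) :
    (g • σ).map p = σ.map p := by
  rw [smul_def, ← map_comp]
  congr 1
  ext e
  exact hp g e

/-- **For a free action, the action on singular simplices is free**: `g • σ = h • σ ↔ g = h`
(evaluate at a vertex). [cite: Brown1982CohomologyGroups, Ch. I §4] -/
theorem smul_eq_smul_iff [IsCancelSMul G E] {g h : G} {σ : SingularSimplex E n} :
    g • σ = h • σ ↔ g = h := by
  refine ⟨fun hgh => ?_, fun hgh => by rw [hgh]⟩
  have := congrArg (fun τ : SingularSimplex E n => toContinuousMap τ (stdSimplex.vertex 0)) hgh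
  simp only [toContinuousMap_smul, ContinuousMap.comp_apply, smulMap_apply] at this
  exact IsCancelSMul.right_cancel _ _ _ this

/-- For a free action, `g • σ = σ ↔ g = 1`. [cite: Brown1982CohomologyGroups, Ch. I §4] -/
theorem smul_eq_self_iff [IsCancelSMul G E] {g : G} {σ : SingularSimplex E n} :
    g • σ = σ ↔ g = 1 := by
  simpa only [one_smul] using (smul_eq_smul_iff (g := g) (h := (1 : G)) (σ := σ))

end SingularSimplex

/-! ### Singular chains as representations -/

namespace Equivariant

variable (G E)

/-- **The permutation representation of `G` on singular chains** in simplicial degree `n`: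
`g` acts on `(n-simplices of E) →₀ k` by `Finsupp.mapDomain (g • ·)`, i.e. by the chain map of
the homeomorphism `g • ·` (Brown 1982, I §4: "`G` permutes the cells, so `Cₙ(X)` is a
`ℤG`-module"). [cite: Brown1982CohomologyGroups, Ch. I §4] -/
def chainRep (n : SimplexCategoryᵒᵖ) :
    Representation k G ((TopCat.toSSet.obj (TopCat.of E)).obj n →₀ k) where
  toFun g := ((csingularSMod.map k k (smulMap G E g)).app n).hom
  map_one' := by
    rw [smulMap_one, csingularSMod.map_id]
    rfl
  map_mul' g h := by
    rw [smulMap_mul, csingularSMod.map_comp]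
    rfl

variable {k G E} in
/-- The representation on an elementary chain: `g • (r σ) = r (g • σ)`. [cite: Brown1982CohomologyGroups, Ch. I §4] -/
@[simp] theorem chainRep_single {n : ℕ} (g : G) (σ : SingularSimplex E n) (r : k) :
    chainRep k G E (op ⦋n⦌) g (Finsupp.single σ r) = Finsupp.single (g • σ) r :=
  csingularSMod.map_app_hom_single k k (smulMap G E g) σ r

variable {k G E} in
/-- The representation is `Finsupp.mapDomain (g • ·)`. [folklore] -/
theorem chainRep_apply {n : ℕ} (g : G) (c : (TopCat.toSSet.obj (TopCat.of E)).obj (op ⦋n⦌) →₀ k) :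
    chainRep k G E (op ⦋n⦌) g c = Finsupp.mapDomain (fun σ : SingularSimplex E n => g • σ) c :=
  rfl

/-- **The singular simplicial module of a `G`-space as a simplicial representation**: the concrete
simplicial module `csingularSMod k k E` with the permutation representations `chainRep`; the
simplicial operators are equivariant by naturality of push-forward. [cite: Brown1982CohomologyGroups, Ch. I §4] -/
def smod : SimplicialObject (Rep.{u} k G) where
  obj n := Rep.of (chainRep k G E n)
  map {n m} θ := Rep.ofHom
    { toLinearMap := ((csingularSMod k k E).map θ).hom
      isIntertwining' := fun g =>
        (congrArg ModuleCat.Hom.hom ((csingularSMod.map k k (smulMap G E g)).naturality θ)).symm }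
  map_id n := by
    refine Rep.hom_ext (Representation.IntertwiningMap.ext ?_)
    change ((csingularSMod k k E).map (𝟙 n)).hom = LinearMap.id
    rw [CategoryTheory.Functor.map_id]
    rfl
  map_comp θ θ' := by
    refine Rep.hom_ext (Representation.IntertwiningMap.ext ?_)
    change ((csingularSMod k k E).map (θ ≫ θ')).hom = _
    rw [CategoryTheory.Functor.map_comp]
    rfl

/-- **The singular chain complex of a `G`-space as a complex of representations**
`C_•(E; k) ∈ ChainComplex (Rep k G) ℕ` (Brown 1982, I §4). [cite: Brown1982CohomologyGroups, Ch. I §4] -/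
def chains : ChainComplex (Rep.{u} k G) ℕ := AlternatingFaceMapComplex.obj (smod k G E)

/-- Forgetting the action on the simplicial representation gives the concrete simplicial module,
on the nose. [folklore] -/
theorem smod_comp_forget₂ :
    smod k G E ⋙ forget₂ (Rep.{u} k G) (ModuleCat.{u} k) = csingularSMod k k E := rfl

/-- Forgetting the action on `chains k G E` gives the concrete singular chain complex
`csingularChainComplex k k E`, on the nose. [folklore] -/
theorem forget₂_chains :
    ((forget₂ (Rep.{u} k G) (ModuleCat.{u} k)).mapHomologicalComplex _).obj (chains k G E) =
      csingularChainComplex k k E :=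
  Functor.congr_obj (map_alternatingFaceMapComplex (forget₂ (Rep.{u} k G) (ModuleCat.{u} k)))
    (smod k G E)

/-- The chain objects are the permutation representations on concrete chains. [folklore] -/
theorem chains_X (n : ℕ) : (chains k G E).X n = Rep.of (chainRep k G E (op ⦋n⦌)) := rfl

variable {k G E} in
/-- The differential of `chains k G E` is the concrete singular boundary
`∂ (r σ) = ∑ᵢ (-1)ⁱ r (σ ∘ δᵢ)`. [folklore] -/
theorem d_hom_apply (n : ℕ) (c : (TopCat.toSSet.obj (TopCat.of E)).obj (op ⦋n + 1⦌) →₀ k) :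
    ((chains k G E).d (n + 1) n).hom c = csingularChainComplex.bd k n c := by
  change ((AlternatingFaceMapComplex.obj (smod k G E)).d (n + 1) n).hom c = _
  rw [AlternatingFaceMapComplex.obj_d_eq, Rep.sum_hom, Representation.IntertwiningMap.sum_apply,
    csingularChainComplex.bd, LinearMap.sum_apply]
  refine Finset.sum_congr rfl fun i _ => ?_
  rw [Rep.zsmul_hom, Representation.IntertwiningMap.coe_zsmul, Pi.smul_apply,
    LinearMap.smul_apply, ← Int.cast_smul_eq_zsmul k, Int.cast_pow, Int.cast_neg, Int.cast_one]
  rfl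

/-- The differential on an elementary chain. [folklore] -/
theorem d_hom_single (n : ℕ) (σ : SingularSimplex E (n + 1)) (r : k) :
    ((chains k G E).d (n + 1) n).hom (Finsupp.single σ r) =
      ∑ i : Fin (n + 2), ((-1 : k) ^ (i : ℕ)) • (Finsupp.single (σ.face i) r : CChain k E n) := by
  rw [d_hom_apply, csingularChainComplex.bd_single]

/-! ### Free `G`-sets: `S ≃ (S/G) × G` equivariantly -/

section FreeSet

variable {G}
variable {S : Type u} [MulAction G S]

/-- `s` lies in the `G`-orbit of the chosen representative of its orbit. [folklore] -/
theorem exists_smul_out_eq (s : S) :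
    ∃ g : G, g • (Quotient.mk'' s : MulAction.orbitRel.Quotient G S).out = s := by
  obtain ⟨g, hg⟩ := MulAction.orbitRel_apply.1 (Quotient.mk_out' (s₁ := MulAction.orbitRel G S) s)
  exact ⟨g⁻¹, by rw [← hg, inv_smul_smul]⟩

/-- A group coordinate of `s` relative to the chosen representative of its orbit:
`orbitIdx s • ⟦s⟧.out = s`. [folklore] -/
def orbitIdx (s : S) : G := Classical.choose (exists_smul_out_eq (G := G) s)

/-- The defining property of `orbitIdx`. [folklore] -/
theorem orbitIdx_smul_out (s : S) :
    orbitIdx (G := G) s • (Quotient.mk'' s : MulAction.orbitRel.Quotient G S).out = s :=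
  Classical.choose_spec (exists_smul_out_eq (G := G) s)

/-- `⟦g • s⟧ = ⟦s⟧` in the orbit space. [folklore] -/
theorem orbitRel_mk_smul (g : G) (s : S) :
    (Quotient.mk'' (g • s) : MulAction.orbitRel.Quotient G S) = Quotient.mk'' s :=
  Quotient.sound' (MulAction.orbitRel_apply.2 (MulAction.mem_orbit s g))

variable [IsCancelSMul G S]

/-- For a free action, the group coordinate is equivariant: `orbitIdx (g • s) = g * orbitIdx s`.
[folklore] -/
theorem orbitIdx_smul (g : G) (s : S) : orbitIdx (G := G) (g • s) = g * orbitIdx (G := G) s := by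
  have h := orbitIdx_smul_out (G := G) (g • s)
  rw [orbitRel_mk_smul] at h
  conv_rhs at h => rw [← orbitIdx_smul_out (G := G) s, smul_smul]
  exact IsCancelSMul.right_cancel _ _ _ h

/-- For a free action, the representative of an orbit has group coordinate `1`. [folklore] -/
theorem orbitIdx_out (q : MulAction.orbitRel.Quotient G S) : orbitIdx (G := G) q.out = 1 := by
  have h := orbitIdx_smul_out (G := G) q.out
  rw [Quotient.out_eq'] at h
  conv_rhs at h => rw [← one_smul G q.out]
  exact IsCancelSMul.right_cancel _ _ _ h

variable (G S) in
/-- **A free `G`-set is `(S/G) × G`**: `s ↦ (⟦s⟧, orbitIdx s)`, inverse `(q, g) ↦ g • q.out`.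
[folklore] -/
def freeEquivProd : S ≃ MulAction.orbitRel.Quotient G S × G where
  toFun s := (Quotient.mk'' s, orbitIdx (G := G) s)
  invFun p := p.2 • p.1.out
  left_inv s := orbitIdx_smul_out (G := G) s
  right_inv p := by
    obtain ⟨q, g⟩ := p
    simp only [Prod.mk.injEq]
    refine ⟨?_, ?_⟩
    · rw [orbitRel_mk_smul, Quotient.out_eq']
    · rw [orbitIdx_smul, orbitIdx_out, mul_one]

/-- The equivariance of `freeEquivProd`: `g • s ↦ (⟦s⟧, g * orbitIdx s)`. [folklore] -/
theorem freeEquivProd_smul (g : G) (s : S) :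
    freeEquivProd G S (g • s) = ((freeEquivProd G S s).1, g * (freeEquivProd G S s).2) := by
  change ((Quotient.mk'' (g • s) : MulAction.orbitRel.Quotient G S), orbitIdx (g • s)) =
    ((Quotient.mk'' s : MulAction.orbitRel.Quotient G S), g * orbitIdx s)
  rw [orbitRel_mk_smul, orbitIdx_smul]

variable (G S) in
/-- **The linearisation of a free `G`-set is a free representation**: the `k`-linear
isomorphism `(S →₀ k) ≃ (S/G →₀ k[G])`, `r s ↦ r (⟦s⟧ ↦ orbitIdx s)`. [cite: Brown1982CohomologyGroups, Ch. I §4] -/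
def finsuppEquivFree : (S →₀ k) ≃ₗ[k] (MulAction.orbitRel.Quotient G S →₀ MonoidAlgebra k G) :=
  (Finsupp.domLCongr (freeEquivProd G S)).trans
    ((Finsupp.curryLinearEquiv k).trans
      (Finsupp.mapRange.linearEquiv (MonoidAlgebra.coeffLinearEquiv k).symm))

/-- `finsuppEquivFree` on an elementary vector. [folklore] -/
@[simp] theorem finsuppEquivFree_single (s : S) (r : k) :
    finsuppEquivFree k G S (Finsupp.single s r) =
      Finsupp.single (Quotient.mk'' s) (MonoidAlgebra.single (orbitIdx (G := G) s) r) := by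
  simp only [finsuppEquivFree, LinearEquiv.trans_apply, Finsupp.domLCongr_single,
    Finsupp.curryLinearEquiv_apply, Finsupp.curry_single]
  rw [Finsupp.mapRange.linearEquiv_apply]
  simp only [Finsupp.mapRange_single]
  rfl

end FreeSet

/-! ### The chain representations of a free `G`-space are free, hence projective -/

variable {G E} in
/-- For a free action on `E`, the action on singular simplices is free (cancellative). [folklore] -/
instance SingularSimplex.instIsCancelSMul [IsCancelSMul G E] (n : ℕ) :
    IsCancelSMul G (SingularSimplex E n) where
  left_cancel' g σ τ h := by simpa using congrArg (fun ρ => g⁻¹ • ρ) h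
  right_cancel' _ _ _ h := SingularSimplex.smul_eq_smul_iff.1 h

/-- **`Cₙ(E; k)` is a free representation for a free action** (Brown 1982, I §4; Hatcher 2002,
§1.B p. 90: "`Cₙ(X̃)` is a free `ℤ[G]`-module with basis obtained by choosing one lift of each
singular simplex"): `Cₙ(E; k) ≅ Rep.free k G (orbits of n-simplices)`. [cite: Brown1982CohomologyGroups, Ch. I §4] -/
def chainsXIsoFree [IsCancelSMul G E] (n : ℕ) :
    (chains k G E).X n ≅ Rep.free k G (MulAction.orbitRel.Quotient G (SingularSimplex E n)) :=
  Rep.mkIso (Representation.Equiv.mk (finsuppEquivFree k G (SingularSimplex E n)) fun g => by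
    refine Finsupp.lhom_ext fun σ r => ?_
    rw [LinearMap.comp_apply, LinearMap.comp_apply]
    change finsuppEquivFree k G (SingularSimplex E n) (chainRep k G E (op ⦋n⦌) g (Finsupp.single σ r))
      = Representation.free k G _ g (finsuppEquivFree k G (SingularSimplex E n) (Finsupp.single σ r))
    rw [chainRep_single, finsuppEquivFree_single, finsuppEquivFree_single,
      Representation.free_single_single, orbitRel_mk_smul, orbitIdx_smul])

/-- **The chain representations of a free `G`-space are projective** in `Rep k G`.
[cite: Brown1982CohomologyGroups, Ch. I §4] -/
instance projective_X [IsCancelSMul G E] (n : ℕ) : Projective ((chains k G E).X n) :=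
  Projective.of_iso (chainsXIsoFree k G E n).symm inferInstance

/-! ### The augmentation and the resolution -/

/-- **The augmentation** `ε : C₀(E; k) → k`, `∑ rᵢ [eᵢ] ↦ ∑ rᵢ`, as a morphism of representations
to the trivial representation (Brown 1982, I §4). [cite: Brown1982CohomologyGroups, Ch. I §4] -/
def εHom : (chains k G E).X 0 ⟶ Rep.trivial k G k :=
  Rep.ofHom
    { toLinearMap := CChain.eps k k (X := E)
      isIntertwining' := fun g => by
        refine Finsupp.lhom_ext fun σ r => ?_
        rw [LinearMap.comp_apply, LinearMap.comp_apply]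
        change CChain.eps k k (chainRep k G E (op ⦋0⦌) g (Finsupp.single σ r)) =
          Representation.trivial k G k g (CChain.eps k k (Finsupp.single σ r))
        rw [chainRep_single, CChain.eps_single, CChain.eps_single, Representation.trivial_apply] }

/-- `ε` on an elementary `0`-chain. [folklore] -/
@[simp] theorem εHom_single (σ : SingularSimplex E 0) (r : k) :
    (εHom k G E).hom (Finsupp.single σ r) = r :=
  CChain.eps_single k k σ r

/-- `∂ ≫ ε = 0`. [cite: Brown1982CohomologyGroups, Ch. I §4] -/
theorem d_comp_εHom : (chains k G E).d 1 0 ≫ εHom k G E = 0 := by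
  refine Rep.hom_ext (Representation.IntertwiningMap.ext ?_)
  refine Finsupp.lhom_ext fun σ r => ?_
  change CChain.eps k k (((chains k G E).d 1 0).hom (Finsupp.single σ r)) = 0
  rw [d_hom_apply, CChain.eps_bd]

/-- **The augmented singular chain complex of a `G`-space** as a morphism of complexes of
representations `C_•(E; k) ⟶ k` (`k` in degree `0`). [cite: Brown1982CohomologyGroups, Ch. I §4] -/
def ε : chains k G E ⟶ (ChainComplex.single₀ (Rep.{u} k G)).obj (Rep.trivial k G k) :=
  ((chains k G E).toSingle₀Equiv (Rep.trivial k G k)).symm ⟨εHom k G E, d_comp_εHom k G E⟩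

/-- The degree-`0` component of `ε` is the augmentation. [folklore] -/
@[simp] theorem ε_f_zero : (ε k G E).f 0 = εHom k G E := by
  simp [ε]

/-- Exactness of `chains k G E` is exactness of the concrete singular chain complex (the forgetful
functor to modules is faithful and exact). [folklore] -/
theorem exactAt_chains_iff (i : ℕ) :
    (chains k G E).ExactAt i ↔ (csingularChainComplex k k E).ExactAt i := by
  rw [HomologicalComplex.exactAt_iff, HomologicalComplex.exactAt_iff,
    ← ShortComplex.exact_map_iff_of_faithful ((chains k G E).sc i)
      (forget₂ (Rep.{u} k G) (ModuleCat.{u} k))]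
  have h : ((chains k G E).sc i).map (forget₂ (Rep.{u} k G) (ModuleCat.{u} k)) =
      (csingularChainComplex k k E).sc i := by
    rw [← forget₂_chains k G E]
    rfl
  rw [h]

/-- **The augmentation is surjective** (as soon as `E` is nonempty). [folklore] -/
theorem epi_εHom [Nonempty E] : Epi (εHom k G E) := by
  refine (forget₂ (Rep.{u} k G) (ModuleCat.{u} k)).epi_of_epi_map ?_
  rw [ModuleCat.epi_iff_surjective]
  intro r
  obtain ⟨e⟩ := ‹Nonempty E›
  exact ⟨Finsupp.single (SingularSimplex.ofPoint e) r, εHom_single k G E _ r⟩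

/-- **`C₁(E; k) →∂ C₀(E; k) →ε k` is exact for path connected `E`** (Hatcher 2002, Prop. 2.7:
a `0`-chain with coefficient sum zero is a boundary), as a short complex of representations.
[cite: HatcherAT2002, Prop. 2.7] -/
theorem exact_d_εHom [PathConnectedSpace E] :
    (ShortComplex.mk ((chains k G E).d 1 0) (εHom k G E) (d_comp_εHom k G E)).Exact := by
  rw [← ShortComplex.exact_map_iff_of_faithful _ (forget₂ (Rep.{u} k G) (ModuleCat.{u} k)),
    ShortComplex.moduleCat_exact_iff]
  intro (z : CChain k E 0) (hz : CChain.eps k k z = 0)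
  have hzu : z ∈ chainsIn k k E Set.univ 0 :=
    (mem_chainsIn_iff k k z).2 fun _ _ => Set.subset_univ _
  obtain ⟨w, -, hw⟩ := exists_bd_eq_of_eps_eq_zero k k isPathConnected_univ hzu hz
  exact ⟨w, by rw [← hw]; exact d_hom_apply 0 w⟩

/-- **The augmented singular chain complex of a path connected, acyclic `G`-space is a
quasi-isomorphism onto `k`**: degree `0` by `exact_d_εHom`/`epi_εHom`, positive degrees by the
vanishing of the singular homology of `E` (Brown 1982, Prop. I.4.1: "if `X` is contractible then
`C_*(X) → ℤ` is a resolution"). [cite: Brown1982CohomologyGroups, Ch. I Prop. 4.1] -/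
theorem quasiIso_ε [PathConnectedSpace E]
    (hE : ∀ n : ℕ, IsZero (csingularHomology k k E (n + 1))) : QuasiIso (ε k G E) := by
  refine ⟨fun n => ?_⟩
  cases n with
  | zero =>
    rw [ChainComplex.quasiIsoAt₀_iff, ShortComplex.quasiIso_iff_of_zeros']
    · simp only [HomologicalComplex.shortComplexFunctor'_map_τ₂, ε_f_zero]
      exact ⟨exact_d_εHom k G E, epi_εHom k G E⟩
    all_goals rfl
  | succ n =>
    rw [quasiIsoAt_iff_exactAt' _ _ (ChainComplex.exactAt_succ_single_obj _ _),
      exactAt_chains_iff, HomologicalComplex.exactAt_iff_isZero_homology]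
    exact hE n

/-- **The free resolution of `k` by the singular chains of a free, path connected, acyclic
`G`-space** (Brown 1982, Ch. I Prop. 4.1–4.2 / Ex. §4: "`C_*(X) → ℤ` is a free resolution of
`ℤ` over `ℤG`"), as a `ProjectiveResolution` of the trivial representation in `Rep k G`; its
`isoExt` computes Mathlib's group cohomology (`groupCohomologyIsoExt`).
[cite: Brown1982CohomologyGroups, Ch. I Prop. 4.1] -/
def resolution [IsCancelSMul G E] [PathConnectedSpace E]
    (hE : ∀ n : ℕ, IsZero (csingularHomology k k E (n + 1))) :
    ProjectiveResolution (Rep.trivial k G k) where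
  complex := chains k G E
  π := ε k G E
  quasiIso := quasiIso_ε k G E hE

/-- The complex of the resolution is `chains k G E`. [folklore] -/
@[simp] theorem resolution_complex [IsCancelSMul G E] [PathConnectedSpace E]
    (hE : ∀ n : ℕ, IsZero (csingularHomology k k E (n + 1))) :
    (resolution k G E hE).complex = chains k G E := rfl


end Equivariant

end Literature.AlgebraicTopology.SingularHomology
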